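import Summits.BirchSwinnertonDyer.Rank1Residual.X11b.NeronIdentityReceptacle
import Literature.NumberTheory.EllipticCurves.TamagawaVariableChangeProofs
import Literature.NumberTheory.EllipticCurves.TamagawaSubgroupProofs
import Literature.NumberTheory.EllipticCurves.GoodReductionLangLift
import Literature.NumberTheory.EllipticCurves.LocalKummerIsotropyTransport
import HarnessLib

/-!
# T1 JET (cell `bsd-jet`), road K, K-GAP-2 (`h49str`), step (B): the receptacle on RATIONAL points —
# `E⁰(K̄_v) ∩ E(K_v) = E₀(K_v)` for the minimal equation

HONEST FRAMING (programme file §HONESTY, verbatim): «no tranche here proves BSD; ARM L moves the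
LITERAL column of an r ≤ 1 census into the kernel-proved-modulo-named-print column.» THEOREMS ONLY
(seat `bsd-jet-pv-1`, session g7; `--supports stmt-BirchSwinnertonDyer-14418`, helper); 0 classes
move. WHAT THIS IS. x11b3's receptacle `X11b.E0Receptacle X v ≤ E(K̄_v)` ("`E⁰(K̄_v)`", points with
nonsingular reduction on the chosen minimal model `M = X.localMinimalIntegralModel v` read over the
valuation ring `𝒪_w` of `K̄_v`) is where [GZ86 III (3.1)] (`hGZ`) and Milne *ADT* I.3.8 live; the
STRINGENT local condition of Jetchev (`JET.stringentFamily`, §3.1) is `δ_v(E₀(K_v))` for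
`E₀(K_v) = goodReductionSubgroup 𝓞_v (X ⊗ K_v)`, the good-reduction subgroup of the (minimal) base
change. This file identifies the two on `K_v`-rational points:

* `hasNonsingularReduction_map_some_algebraMap_iff` — for `J/𝓞_v` and a `K_v`-point `(x, y)`:
  nonsingular reduction on the `𝒪_w`-model `J.map ι` (at `(x, y) ∈ J(K̄_v)`) iff nonsingular reduction
  on `J` (over `𝓞_v`): `𝒪_w ∩ K_v = 𝓞_v` (`|·|_w` extends `|·|_v`) and the residue map `k_v → k_w`
  induced by the local homomorphism `ι` is a field embedding (Mathlib `Affine.map_nonsingular`).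
* `mem_goodReductionSubgroup_of_mem_E0Receptacle` — for `X/K` whose base change to `K_v` is
  `𝓞_v`-minimal and `t ∈ E(K_v)`: if the image of `t` in `E(K̄_v)` lies in `E⁰(K̄_v)` then
  `t ∈ E₀(K_v)`. The two minimal equations (`X ⊗ K_v` and `M ⊗ K_v`) differ by an `𝓞_v`-integral
  change of variables (Silverman VII.1.3(b), tree `exists_variableChange_integralModel_eq`), which
  preserves nonsingular reduction (tree `isNonsingularReductionPoint_pointEquiv_iff`).
References: [cite: SilvermanAEC2009, VII.1 Prop. 1.3(b) (PDF p. 165), VII.2 Prop. 2.1 (PDF p. 167)]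
[cite: Jetchev2008, §3.1 (p. 814)] [cite: GrossZagier1986, III (3.1)] [cite: NeukirchANT1999, Ch. II (4.8)].
-/

set_option autoImplicit false

noncomputable section

open scoped Classical NNReal

namespace Summit.BirchSwinnertonDyer.Rank1Residual.JET.Receptacle

open WeierstrassCurve Literature.NumberTheory.EllipticCurves NumberField IsDedekindDomain
  IsDedekindDomain.HeightOneSpectrum Summit.BirchSwinnertonDyer.Rank1Residual.X11b

universe u

variable {K : Type u} [Field K] [NumberField K] {v : HeightOneSpectrum (𝓞 K)}
  {w : Valuation (AlgebraicClosure (v.adicCompletion K)) ℝ≥0}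
  (hw : ∀ x, (w x : ℝ) = spectralNorm (v.adicCompletion K) (AlgebraicClosure (v.adicCompletion K)) x)
  {ι : v.adicCompletionIntegers K →+* w.integer}
  (hι : ∀ a, ((ι a : w.integer) : AlgebraicClosure (v.adicCompletion K)) =
    algebraMap (v.adicCompletion K) (AlgebraicClosure (v.adicCompletion K)) (a : v.adicCompletion K))

/-! ## §1 Nonsingular reduction of a `K_v`-point: over `𝓞_v` or over `𝒪_w` -/

include hw hι in
/-- **Nonsingular reduction of a `K_v`-rational point is the same on `J/𝓞_v` and on its `𝒪_w`-model
`J.map ι`** (`𝒪_w` the valuation ring of `K̄_v`, `ι : 𝓞_v → 𝒪_w` the structure map): `x ∈ 𝓞_v` iff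
`|x|_w ≤ 1` (`spectralValuation_algebraMap_le_one_iff`), `ι` is local (`isLocalHom_of_coe_eq`) so the
induced map of residue fields `k_v → k_w` is an embedding, under which nonsingularity of
`(x̄, ȳ)` on the reduced equation is invariant (Mathlib `Affine.map_nonsingular`).
[cite: SilvermanAEC2009, VII.2 (definition of `E₀`, PDF p. 167)] [cite: NeukirchANT1999, Ch. II (4.8)] -/
theorem hasNonsingularReduction_map_some_algebraMap_iff (J : WeierstrassCurve (v.adicCompletionIntegers K))
    {x y : v.adicCompletion K} (h : (J.baseChange (v.adicCompletion K)).toAffine.Nonsingular x y)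
    (h' : ((J.map ι).baseChange (AlgebraicClosure (v.adicCompletion K))).toAffine.Nonsingular
      (algebraMap (v.adicCompletion K) (AlgebraicClosure (v.adicCompletion K)) x)
      (algebraMap (v.adicCompletion K) (AlgebraicClosure (v.adicCompletion K)) y)) :
    (J.map ι).HasNonsingularReduction (.some _ _ h') ↔ J.HasNonsingularReduction (.some x y h) := by
  have hvw : w.Integers w.integer := Valuation.integer.integers w
  haveI hloc := isLocalHom_of_coe_eq hw hι
  -- integrality of an element of `K_v`, read through `w`
  have hint : ∀ z : v.adicCompletion K,
      (∃ a : w.integer, algebraMap w.integer (AlgebraicClosure (v.adicCompletion K)) a =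
        algebraMap (v.adicCompletion K) (AlgebraicClosure (v.adicCompletion K)) z) ↔
      z ∈ v.adicCompletionIntegers K := by
    intro z
    rw [← spectralValuation_algebraMap_le_one_iff hw z]
    exact exists_algebraMap_eq_iff hvw
  -- the residue fields: `res_w ∘ ι = κ ∘ res_v`, `κ = ResidueField.map ι` a field embedding
  have hres : ∀ a : v.adicCompletionIntegers K, IsLocalRing.residue w.integer (ι a) =
      IsLocalRing.ResidueField.map ι (IsLocalRing.residue (v.adicCompletionIntegers K) a) :=
    fun a ↦ (IsLocalRing.ResidueField.map_residue ι a).symm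
  have hred : (J.map ι).map (IsLocalRing.residue w.integer) =
      (J.map (IsLocalRing.residue (v.adicCompletionIntegers K))).map (IsLocalRing.ResidueField.map ι) := by
    rw [WeierstrassCurve.map_map, WeierstrassCurve.map_map, residue_comp_eq_map_comp_residue hw hι]
  change ((algebraMap (v.adicCompletion K) (AlgebraicClosure (v.adicCompletion K)) x ∉
        Set.range (algebraMap w.integer (AlgebraicClosure (v.adicCompletion K)))) ∨
      ∃ a b : w.integer, algebraMap w.integer (AlgebraicClosure (v.adicCompletion K)) a =
          algebraMap (v.adicCompletion K) (AlgebraicClosure (v.adicCompletion K)) x ∧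
        algebraMap w.integer (AlgebraicClosure (v.adicCompletion K)) b =
          algebraMap (v.adicCompletion K) (AlgebraicClosure (v.adicCompletion K)) y ∧
        ((J.map ι).map (IsLocalRing.residue w.integer)).toAffine.Nonsingular
          (IsLocalRing.residue w.integer a) (IsLocalRing.residue w.integer b)) ↔
    ((x ∉ Set.range (algebraMap (v.adicCompletionIntegers K) (v.adicCompletion K))) ∨
      ∃ x₀ y₀ : v.adicCompletionIntegers K,
        algebraMap (v.adicCompletionIntegers K) (v.adicCompletion K) x₀ = x ∧
        algebraMap (v.adicCompletionIntegers K) (v.adicCompletion K) y₀ = y ∧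
        (J.map (IsLocalRing.residue (v.adicCompletionIntegers K))).toAffine.Nonsingular
          (IsLocalRing.residue (v.adicCompletionIntegers K) x₀)
          (IsLocalRing.residue (v.adicCompletionIntegers K) y₀))
  refine or_congr (not_congr ⟨?_, ?_⟩) ⟨?_, ?_⟩
  · rintro ⟨a, ha⟩
    exact ⟨⟨x, (hint x).mp ⟨a, ha⟩⟩, rfl⟩
  · rintro ⟨x₀, rfl⟩
    exact ⟨ι x₀, hι x₀⟩
  · rintro ⟨a, b, ha, hb, hns⟩
    have hx : x ∈ v.adicCompletionIntegers K := (hint x).mp ⟨a, ha⟩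
    have hy : y ∈ v.adicCompletionIntegers K := (hint y).mp ⟨b, hb⟩
    have ha' : a = ι ⟨x, hx⟩ := hvw.hom_inj (ha.trans (hι ⟨x, hx⟩).symm)
    have hb' : b = ι ⟨y, hy⟩ := hvw.hom_inj (hb.trans (hι ⟨y, hy⟩).symm)
    refine ⟨⟨x, hx⟩, ⟨y, hy⟩, rfl, rfl, ?_⟩
    rw [ha', hb', hred, hres, hres] at hns
    exact (Affine.map_nonsingular _ (IsLocalRing.ResidueField.map ι).injective _ _).mp hns
  · rintro ⟨x₀, y₀, rfl, rfl, hns⟩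
    refine ⟨ι x₀, ι y₀, hι x₀, hι y₀, ?_⟩
    rw [hred, hres, hres]
    exact (Affine.map_nonsingular _ (IsLocalRing.ResidueField.map ι).injective _ _).mpr hns

/-! ## §2 `E⁰(K̄_v) ∩ E(K_v) ⊆ E₀(K_v)` for the minimal base change -/

omit hw hι w ι in
/-- Transport of `IsNonsingularReductionPoint` along an EQUALITY of (minimal) equations. [folklore] -/
theorem isNonsingularReductionPoint_congrEquiv_iff {R : Type*} [CommRing R] [IsDomain R]
    [IsDiscreteValuationRing R] {F : Type*} [Field F] [Algebra R F] [IsFractionRing R F]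
    {W₁ W₂ : WeierstrassCurve F} (h : W₁ = W₂) [W₁.IsMinimal R] [W₂.IsMinimal R]
    (P : W₁.toAffine.Point) :
    W₂.IsNonsingularReductionPoint R (Affine.Point.congrEquiv h P) ↔ W₁.IsNonsingularReductionPoint R P := by
  subst h
  rfl

/-- **`E⁰(K̄_v) ∩ E(K_v) ⊆ E₀(K_v)`.** Let `X/K` be elliptic with `X ⊗ K_v` minimal over `𝓞_v`, and
`t ∈ E(K_v)`. If the image of `t` in `E(K̄_v) = localPoints X K_v` lies in the receptacle
`E0Receptacle X v` (nonsingular reduction on the chosen minimal model `M ⊗ 𝒪_w`), then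
`t ∈ goodReductionSubgroup 𝓞_v (X ⊗ K_v)`: the chosen `C₀` with `C₀ • (X ⊗ K_v) = M ⊗ K_v` is the image
of an `𝓞_v`-integral change of variables (Silverman VII.1.3(b): both equations are minimal), reduction
commutes with it (VII.2), and on the `K_v`-point `C₀ • t` nonsingular reduction over `𝒪_w` is
nonsingular reduction over `𝓞_v` (§1). [cite: SilvermanAEC2009, VII.1 Prop. 1.3(b), VII.2 Prop. 2.1]
[cite: Jetchev2008, §3.1 (p. 814)] -/
theorem mem_goodReductionSubgroup_of_mem_E0Receptacle (X : WeierstrassCurve K) [X.IsElliptic]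
    (v : HeightOneSpectrum (𝓞 K))
    [hmin : (X.baseChange (v.adicCompletion K)).IsMinimal (v.adicCompletionIntegers K)]
    (t : (X.baseChange (v.adicCompletion K)).toAffine.Point)
    (ht : X.baseChangeGeomPointsEquiv (v.adicCompletion K)
      (toGeomPoints (X.baseChange (v.adicCompletion K)) t) ∈ E0Receptacle X v) :
    t ∈ (X.baseChange (v.adicCompletion K)).goodReductionSubgroup (v.adicCompletionIntegers K) := by
  rcases t with _ | ⟨x, y, hxy⟩
  · exact AddSubgroup.zero_mem _
  -- the chosen witnesses of the receptacle: `w`, `ι : 𝓞_v → 𝒪_w`, `C` with `C • X_v = M_v`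
  have hw := (v.exists_spectralValuation).choose_spec
  have hι := (exists_ringHom_adicCompletionIntegers_integer
    (v.exists_spectralValuation).choose_spec).choose_spec
  have hC := (X.exists_variableChange_eq_localMinimalIntegralModel v).choose_spec
  have hvw : (v.exists_spectralValuation).choose.Integers (v.exists_spectralValuation).choose.integer :=
    Valuation.integer.integers _
  -- `M_v = M ⊗ K_v` is minimal (it is the chosen local minimal model)
  have hM : (X.localMinimalIntegralModel v).map
      (algebraMap (v.adicCompletionIntegers K) (v.adicCompletion K)) = X.localMinimalModel v :=
    baseChange_integralModel_eq (v.adicCompletionIntegers K) (X.localMinimalModel v)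
  haveI hMmin : ((X.localMinimalIntegralModel v).map
      (algebraMap (v.adicCompletionIntegers K) (v.adicCompletion K))).IsMinimal
      (v.adicCompletionIntegers K) := by
    rw [hM]; infer_instance
  haveI hMmin' : ((X.localMinimalIntegralModel v).baseChange (v.adicCompletion K)).IsMinimal
      (v.adicCompletionIntegers K) := hMmin
  -- Silverman VII.1.3(b): `C` is the image of an `𝓞_v`-integral change of variables `D'`
  have hΔ : (X.baseChange (v.adicCompletion K)).Δ ≠ 0 := (X.baseChange (v.adicCompletion K)).isUnit_Δ.ne_zero
  obtain ⟨D', hD', hI⟩ := exists_variableChange_integralModel_eq (v.adicCompletionIntegers K) hC.symm hΔ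
  have hDC : D'.map (algebraMap (v.adicCompletionIntegers K) (v.adicCompletion K)) •
      X.baseChange (v.adicCompletion K) =
      (X.localMinimalIntegralModel v).map (algebraMap (v.adicCompletionIntegers K) (v.adicCompletion K)) := by
    rw [hD']; exact hC
  haveI : (D'.map (algebraMap (v.adicCompletionIntegers K) (v.adicCompletion K)) •
      X.baseChange (v.adicCompletion K)).IsMinimal (v.adicCompletionIntegers K) := by
    rw [hDC]; exact hMmin
  have hI' : integralModel (v.adicCompletionIntegers K)
      (D'.map (algebraMap (v.adicCompletionIntegers K) (v.adicCompletion K)) •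
        X.baseChange (v.adicCompletion K)) =
      D' • integralModel (v.adicCompletionIntegers K) (X.baseChange (v.adicCompletion K)) := by
    rw [← hI]; congr 1
  -- the transported point: `C • (x, y)` with coordinates in `K_v`
  have hxy' : ((X.localMinimalIntegralModel v).map (algebraMap (v.adicCompletionIntegers K)
      (v.adicCompletion K))).toAffine.Nonsingular
      ((D'.map (algebraMap (v.adicCompletionIntegers K) (v.adicCompletion K))).toX x)
      ((D'.map (algebraMap (v.adicCompletionIntegers K) (v.adicCompletion K))).toY x y) := by
    rw [← hDC]
    exact (VariableChange.nonsingular_iff _ _ x y).mpr hxy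
  -- STEP 1: read the receptacle hypothesis on the coordinates of `C • (x, y)`
  rw [mem_E0Receptacle_iff] at ht
  change ((X.localMinimalIntegralModel v).map _).HasNonsingularReduction
    (Affine.Point.congrEquiv _ (Affine.Point.congrEquiv _
      (VariableChange.pointEquivBaseChange (X.baseChange (v.adicCompletion K)) _ _
        (Affine.Point.congrEquiv _ (X.baseChangeGeomPointsEquiv (v.adicCompletion K)
          (Affine.Point.map (W' := X.baseChange (v.adicCompletion K))
            (Algebra.ofId (v.adicCompletion K) (AlgebraicClosure (v.adicCompletion K)))
            (.some x y hxy))))))) at ht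
  have e1 : Affine.Point.congrEquiv (baseChange_baseChange_adicCompletion X v).symm
      (X.baseChangeGeomPointsEquiv (v.adicCompletion K)
        (Affine.Point.map (W' := X.baseChange (v.adicCompletion K))
          (Algebra.ofId (v.adicCompletion K) (AlgebraicClosure (v.adicCompletion K)))
          (.some x y hxy))) =
      Affine.Point.map (W' := X.baseChange (v.adicCompletion K))
        (Algebra.ofId (v.adicCompletion K) (AlgebraicClosure (v.adicCompletion K)))
        (.some x y hxy) :=
    congrEquiv_apply_congrEquiv_symm _ _
  rw [e1, Affine.Point.map_some, VariableChange.pointEquivBaseChange_some, Affine.Point.congrEquiv_some,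
    Affine.Point.congrEquiv_some] at ht
  have ex : (((X.exists_variableChange_eq_localMinimalIntegralModel v).choose).map
        (algebraMap (v.adicCompletion K) (AlgebraicClosure (v.adicCompletion K)))).toX
        (Algebra.ofId (v.adicCompletion K) (AlgebraicClosure (v.adicCompletion K)) x) =
      algebraMap (v.adicCompletion K) (AlgebraicClosure (v.adicCompletion K))
        ((D'.map (algebraMap (v.adicCompletionIntegers K) (v.adicCompletion K))).toX x) := by
    rw [hD']; exact (VariableChange.ringHom_toX _ _ x).symm
  have ey : (((X.exists_variableChange_eq_localMinimalIntegralModel v).choose).map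
        (algebraMap (v.adicCompletion K) (AlgebraicClosure (v.adicCompletion K)))).toY
        (Algebra.ofId (v.adicCompletion K) (AlgebraicClosure (v.adicCompletion K)) x)
        (Algebra.ofId (v.adicCompletion K) (AlgebraicClosure (v.adicCompletion K)) y) =
      algebraMap (v.adicCompletion K) (AlgebraicClosure (v.adicCompletion K))
        ((D'.map (algebraMap (v.adicCompletionIntegers K) (v.adicCompletion K))).toY x y) := by
    rw [hD']; exact (VariableChange.ringHom_toY _ _ x y).symm
  have hxy'' : (((X.localMinimalIntegralModel v).map (exists_ringHom_adicCompletionIntegers_integer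
      (v.exists_spectralValuation).choose_spec).choose).baseChange
      (AlgebraicClosure (v.adicCompletion K))).toAffine.Nonsingular
      (algebraMap (v.adicCompletion K) (AlgebraicClosure (v.adicCompletion K))
        ((D'.map (algebraMap (v.adicCompletionIntegers K) (v.adicCompletion K))).toX x))
      (algebraMap (v.adicCompletion K) (AlgebraicClosure (v.adicCompletion K))
        ((D'.map (algebraMap (v.adicCompletionIntegers K) (v.adicCompletion K))).toY x y)) := by
    rw [← baseChange_map_eq_baseChange_map_choose v]
    exact (Affine.map_nonsingular _ (algebraMap (v.adicCompletion K)
      (AlgebraicClosure (v.adicCompletion K))).injective _ _).mpr hxy'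
  rw [point_some_congr ex ey (h' := hxy'')] at ht
  -- STEP 2: over `𝒪_w` ⇒ over `𝓞_v` (§1), then `Tamagawa` currency on `M_v`
  have h1 : (X.localMinimalIntegralModel v).HasNonsingularReduction (.some _ _ hxy') :=
    (hasNonsingularReduction_map_some_algebraMap_iff hw hι (X.localMinimalIntegralModel v) hxy' hxy'').mp ht
  have h2 : ((X.localMinimalIntegralModel v).map (algebraMap (v.adicCompletionIntegers K)
      (v.adicCompletion K))).IsNonsingularReductionPoint (v.adicCompletionIntegers K) (.some _ _ hxy') :=
    (isNonsingularReductionPoint_iff_hasNonsingularReduction (v.adicCompletionIntegers K)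
      (X.localMinimalIntegralModel v) _).mpr h1
  -- STEP 3: transport along `M_v = D' • X_v` and VII.1.3(b)/VII.2
  have h3 : (D'.map (algebraMap (v.adicCompletionIntegers K) (v.adicCompletion K)) •
      X.baseChange (v.adicCompletion K)).IsNonsingularReductionPoint (v.adicCompletionIntegers K)
      (VariableChange.pointEquiv (X.baseChange (v.adicCompletion K))
        (D'.map (algebraMap (v.adicCompletionIntegers K) (v.adicCompletion K))) (.some x y hxy)) := by
    rw [← isNonsingularReductionPoint_congrEquiv_iff (R := v.adicCompletionIntegers K) hDC,
      VariableChange.pointEquiv_some, Affine.Point.congrEquiv_some]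
    exact h2
  have h4 := (isNonsingularReductionPoint_pointEquiv_iff (v.adicCompletionIntegers K) D' hI' _).mp h3
  exact (WeierstrassCurve.mem_goodReductionSubgroup_iff_holds (v.adicCompletionIntegers K)
    (X.baseChange (v.adicCompletion K)) _).mpr h4

end Summit.BirchSwinnertonDyer.Rank1Residual.JET.Receptacle

end
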